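import Literature.AlgebraicGeometry.AbelianSchemes.AbelianSchemeOverHomNoetherianAnyBase
import Literature.AlgebraicGeometry.Morphisms.FpqcDescentOfMorphisms
import Literature.AlgebraicGeometry.Morphisms.FlatFpqcDescent
import Mathlib.FieldTheory.IsAlgClosed.AlgebraicClosure
import HarnessLib

/-!
# Homomorphisms of abelian schemes agreeing on all geometric fibres are equal (any locally Noetherian base)

Layer `Literature/AlgebraicGeometry/AbelianSchemes`, namespace `Literature.AlgebraicGeometry.AbelianSchemes.AbelianSchemeOver`.
Cell `hodgecm-mathlib` (D-0151), F-DAG F-6 (V) road (α) «any-base editions», the one new lemma of edition α-5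
(B-p17 (g12) census `CENSUS-F6V-LDeltaCubeLocus`, B-plan1 (g16) ruling 2026-08-30T07:39Z); count-neutral capital, PROOF lane,
theorems only (no definition, no named fact, no instance, no `sorry`).  HC_CM is proved only modulo the 7 printed citations until
rung 0 closes; this file asserts nothing about HC.

[MumfordFogartyKirwan1994] Ch. 6 §1, Cor. 6.2 / 6.4 (rigidity; p. 116–117): over a CONNECTED base two homomorphisms of abelian
schemes that agree on ONE geometric fibre agree.  Without connectedness the same rigidity engine gives: **two `S`-morphisms
`f, g : A → G` from an abelian scheme `A/S` (`S` locally Noetherian) to an `S`-group scheme `G`, both compatible with the unit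
section, which agree on EVERY GEOMETRIC POINT of `A` — equivalently on every geometric fibre `A_s̄ = A ×_S Spec Ω` — are
equal.**  Proof: ★ `hom_eq_of_forall_fromSpecResidueField_comp_eq_of_stein` (the any-base engine: Stein + a section + agreement
at every residue-field point of `A`) — and agreement at the residue-field point `Spec κ(z) → A` follows from agreement at the
geometric point `Spec κ(z)⁻ → Spec κ(z) → A` because `Spec κ(z)⁻ → Spec κ(z)` is an fpqc cover, hence an epimorphism
(★ `FpqcDescentOfMorphisms.hom_ext_of_fpqc`, ★ `surjective_and_flat_SpecMap_of_field`).

* `hom_eq_of_forall_geometricPoint_comp_eq` — agreement on all geometric POINTS `x : Spec Ω → A` (`Ω` algebraically closed);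
* `hom_eq_of_forall_fibre_fst_comp_eq` — agreement on all geometric FIBRES: `pr₁ ≫ f = pr₁ ≫ g` on `A ×_S Spec Ω → A` for every
  geometric point `Spec Ω → S`;
* `IsMonHom` forms (`…_of_isMonHom`) and the abelian-scheme-target readings;
* **`hom_eq_of_forall_pullback_map_eq_of_isLocallyNoetherian_base`** — the `Over.pullback` form consumed by the any-base
  editions: `(Over.pullback t).map f = (Over.pullback t).map g` for every geometric point `t : Spec Ω → S` ⇒ `f = g`
  (any-base twin of ★ `hom_eq_of_pullback_map_eq_of_isLocallyNoetherian`, which needs `S` preconnected and ONE point).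

## References
* [MumfordFogartyKirwan1994] D. Mumford, J. Fogarty, F. Kirwan, *Geometric Invariant Theory*, 3rd ed. (1994), Ch. 6 §1,
  Prop. 6.1 (pp. 115–116), Cor. 6.2, Cor. 6.4 (p. 117).
* [GortzWedhorn2020] U. Görtz, T. Wedhorn, *Algebraic Geometry I*, 2nd ed. (2020), Thm. 14.72 (fpqc descent of morphisms).
-/

noncomputable section

universe u

open CategoryTheory CategoryTheory.Limits AlgebraicGeometry MonoidalCategory CartesianMonoidalCategory
open scoped MonObj CategoryTheory.Obj

namespace Literature.AlgebraicGeometry.AbelianSchemes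

namespace AbelianSchemeOver

open Literature.AlgebraicGeometry.Morphisms Literature.AlgebraicGeometry.Motives

variable {S : Scheme.{u}} (A : AbelianSchemeOver S)

/-- A morphism out of `Spec κ(z)` is determined by its composite with `Spec κ(z)⁻ → Spec κ(z)` (an fpqc cover is an
epimorphism). [cite: GortzWedhorn2020, Thm. 14.72] -/
theorem hom_ext_specMap_algebraicClosure {K : Type u} [Field K] {X : Scheme.{u}} {f₁ f₂ : Spec (.of K) ⟶ X}
    (h : Spec.map (CommRingCat.ofHom (algebraMap K (AlgebraicClosure K))) ≫ f₁ =
      Spec.map (CommRingCat.ofHom (algebraMap K (AlgebraicClosure K))) ≫ f₂) : f₁ = f₂ := by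
  obtain ⟨h₁, h₂⟩ := surjective_and_flat_SpecMap_of_field (K := CommRingCat.of (AlgebraicClosure K))
    (CommRingCat.ofHom (algebraMap K (AlgebraicClosure K)))
  haveI := h₁
  haveI := h₂
  exact hom_ext_of_fpqc (Spec.map (CommRingCat.ofHom (algebraMap K (AlgebraicClosure K)))) h

/-- **Morphisms from an abelian scheme to a group scheme agreeing on all geometric points are equal — any locally
Noetherian base.**  `A/S` an abelian scheme, `G/S` a group scheme, `f, g : A → G` two `S`-morphisms with `η ≫ f = η ≫ g`
which agree after every geometric point `x : Spec Ω → A` (`Ω` algebraically closed); then `f = g`.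
[cite: MumfordFogartyKirwan1994, Ch. 6 §1 Corollary 6.2 and Corollary 6.4 (p. 117)] -/
theorem hom_eq_of_forall_geometricPoint_comp_eq [IsLocallyNoetherian S] {G : Over S} [GrpObj G] (f g : A.X ⟶ G)
    (he : η[A.X] ≫ f = η[A.X] ≫ g)
    (h : ∀ ⦃Ω : Type u⦄ [Field Ω] [IsAlgClosed Ω] (x : Spec (.of Ω) ⟶ A.X.left), x ≫ f.left = x ≫ g.left) :
    f = g := by
  haveI := A.universallyClosed_hom
  refine hom_eq_of_forall_fromSpecResidueField_comp_eq_of_stein A.app_bijective_of_isLocallyNoetherian η[A.X] f g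
    (fun z => ?_) he
  -- the residue field `κ(z)` and the geometric point `Spec κ(z)⁻ → Spec κ(z) → A`
  let K : Type u := ↥(A.X.left.residueField z)
  have hx := h (Spec.map (CommRingCat.ofHom (algebraMap K (AlgebraicClosure K))) ≫ A.X.left.fromSpecResidueField z)
  simp only [Category.assoc] at hx
  exact hom_ext_specMap_algebraicClosure (K := K) hx

/-- `IsMonHom` form of `hom_eq_of_forall_geometricPoint_comp_eq`: two HOMOMORPHISMS `A → G` agreeing on all geometric points
of `A` are equal. [cite: MumfordFogartyKirwan1994, Ch. 6 §1 Corollary 6.2 and Corollary 6.4 (p. 117)] -/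
theorem hom_eq_of_forall_geometricPoint_comp_eq_of_isMonHom [IsLocallyNoetherian S] {G : Over S} [GrpObj G]
    (f g : A.X ⟶ G) [IsMonHom f] [IsMonHom g]
    (h : ∀ ⦃Ω : Type u⦄ [Field Ω] [IsAlgClosed Ω] (x : Spec (.of Ω) ⟶ A.X.left), x ≫ f.left = x ≫ g.left) :
    f = g :=
  A.hom_eq_of_forall_geometricPoint_comp_eq f g (by rw [IsMonHom.one_hom, IsMonHom.one_hom]) h

/-- **Morphisms from an abelian scheme to a group scheme agreeing on all geometric FIBRES are equal — any locally
Noetherian base**: if `pr₁ ≫ f = pr₁ ≫ g` on the geometric fibre `A ×_S Spec Ω → A` of every geometric point `Spec Ω → S`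
(and `η ≫ f = η ≫ g`), then `f = g`. [cite: MumfordFogartyKirwan1994, Ch. 6 §1 Corollary 6.2 and Corollary 6.4 (p. 117)] -/
theorem hom_eq_of_forall_fibre_fst_comp_eq [IsLocallyNoetherian S] {G : Over S} [GrpObj G] (f g : A.X ⟶ G)
    (he : η[A.X] ≫ f = η[A.X] ≫ g)
    (h : ∀ ⦃Ω : Type u⦄ [Field Ω] [IsAlgClosed Ω] (t : Spec (.of Ω) ⟶ S),
      pullback.fst A.X.hom t ≫ f.left = pullback.fst A.X.hom t ≫ g.left) :
    f = g := by
  refine A.hom_eq_of_forall_geometricPoint_comp_eq f g he fun Ω _ _ x => ?_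
  have hlift : pullback.lift x (𝟙 _) (by simp) ≫ pullback.fst A.X.hom (x ≫ A.X.hom) = x := pullback.lift_fst _ _ _
  rw [← hlift, Category.assoc, Category.assoc, h (x ≫ A.X.hom)]

/-- `IsMonHom` form of `hom_eq_of_forall_fibre_fst_comp_eq`. [cite: MumfordFogartyKirwan1994, Ch. 6 §1 Corollary 6.2 and Corollary 6.4 (p. 117)] -/
theorem hom_eq_of_forall_fibre_fst_comp_eq_of_isMonHom [IsLocallyNoetherian S] {G : Over S} [GrpObj G]
    (f g : A.X ⟶ G) [IsMonHom f] [IsMonHom g]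
    (h : ∀ ⦃Ω : Type u⦄ [Field Ω] [IsAlgClosed Ω] (t : Spec (.of Ω) ⟶ S),
      pullback.fst A.X.hom t ≫ f.left = pullback.fst A.X.hom t ≫ g.left) :
    f = g :=
  A.hom_eq_of_forall_fibre_fst_comp_eq f g (by rw [IsMonHom.one_hom, IsMonHom.one_hom]) h

/-- **Two homomorphisms of abelian schemes `A → B` over any locally Noetherian base agreeing on every geometric fibre are
equal.** [cite: MumfordFogartyKirwan1994, Ch. 6 §1 Corollary 6.2 and Corollary 6.4 (p. 117)] -/
theorem hom_eq_of_forall_fibre_fst_comp_eq_of_isMonHom' [IsLocallyNoetherian S] (B : AbelianSchemeOver S)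
    (f g : A.X ⟶ B.X) [IsMonHom f] [IsMonHom g]
    (h : ∀ ⦃Ω : Type u⦄ [Field Ω] [IsAlgClosed Ω] (t : Spec (.of Ω) ⟶ S),
      pullback.fst A.X.hom t ≫ f.left = pullback.fst A.X.hom t ≫ g.left) :
    f = g :=
  A.hom_eq_of_forall_fibre_fst_comp_eq_of_isMonHom f g h

/-- **Base-change form — ANY locally Noetherian base, no connectedness, no reducedness** (the any-base edition of
★ `hom_eq_of_pullback_map_eq_of_isLocallyNoetherian`): two homomorphisms `f, g : A → G` from an abelian scheme to an
`S`-group scheme whose base changes to EVERY geometric point `t : Spec Ω → S` coincide, `(Over.pullback t).map f =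
(Over.pullback t).map g`, are equal. [cite: MumfordFogartyKirwan1994, Ch. 6 §1 Corollary 6.2 and Corollary 6.4 (p. 117)] -/
theorem hom_eq_of_forall_pullback_map_eq_of_grpObj_of_isLocallyNoetherian_base [IsLocallyNoetherian S] {G : Over S}
    [GrpObj G] (f g : A.X ⟶ G) [IsMonHom f] [IsMonHom g]
    (h : ∀ (Ω : Type u) [Field Ω] [IsAlgClosed Ω] (t : Spec (.of Ω) ⟶ S),
      (Over.pullback t).map f = (Over.pullback t).map g) : f = g := by
  refine A.hom_eq_of_forall_fibre_fst_comp_eq_of_isMonHom f g fun Ω _ _ t => ?_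
  have hf : ((Over.pullback t).map f).left ≫ pullback.fst G.hom t = pullback.fst A.X.hom t ≫ f.left := by
    simp only [Over.pullback_map_left]
    erw [pullback.lift_fst]
  have hg : ((Over.pullback t).map g).left ≫ pullback.fst G.hom t = pullback.fst A.X.hom t ≫ g.left := by
    simp only [Over.pullback_map_left]
    erw [pullback.lift_fst]
  rw [← hf, ← hg, h Ω t]

/-- **Two homomorphisms of abelian schemes over ANY locally Noetherian base whose base changes to every geometric point
coincide are equal** — the head consumed by the any-base edition α-5 of ★ `AbelianSchemeLDeltaLocusOfPolarization`
(there with `A := A.baseChange b`, `B := D.hat.baseChange b` over the test base).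
[cite: MumfordFogartyKirwan1994, Ch. 6 §1 Corollary 6.2 and Corollary 6.4 (p. 117)] -/
theorem hom_eq_of_forall_pullback_map_eq_of_isLocallyNoetherian_base [IsLocallyNoetherian S] {A B : AbelianSchemeOver S}
    (f g : A.X ⟶ B.X) [IsMonHom f] [IsMonHom g]
    (h : ∀ (Ω : Type u) [Field Ω] [IsAlgClosed Ω] (t : Spec (.of Ω) ⟶ S),
      (Over.pullback t).map f = (Over.pullback t).map g) : f = g :=
  A.hom_eq_of_forall_pullback_map_eq_of_grpObj_of_isLocallyNoetherian_base f g h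

/-- The underlying scheme morphisms: two `S`-morphisms `A → G` compatible with the unit whose underlying scheme maps agree on all
geometric points have equal underlying scheme maps. [cite: MumfordFogartyKirwan1994, Ch. 6 §1 Corollary 6.2 and Corollary 6.4 (p. 117)] -/
theorem hom_left_eq_of_forall_geometricPoint_comp_eq [IsLocallyNoetherian S] {G : Over S} [GrpObj G] (f g : A.X ⟶ G)
    (he : η[A.X] ≫ f = η[A.X] ≫ g)
    (h : ∀ ⦃Ω : Type u⦄ [Field Ω] [IsAlgClosed Ω] (x : Spec (.of Ω) ⟶ A.X.left), x ≫ f.left = x ≫ g.left) :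
    f.left = g.left :=
  congrArg CommaMorphism.left (A.hom_eq_of_forall_geometricPoint_comp_eq f g he h)

end AbelianSchemeOver

end Literature.AlgebraicGeometry.AbelianSchemes

end
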